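import Summits.BirchSwinnertonDyer.Rank1Residual.P2.KrizLiTwoFortyThreeMembership
import Summits.BirchSwinnertonDyer.Rank1Residual.P2.KrizLiTwoFortyThreeGoodAtTwo
import Literature.NumberTheory.EllipticCurves.Rank1Residual.X11RankOneCertificates.Minimality
import Literature.NumberTheory.EllipticCurves.Rank1Residual.CornerFTwoCertificates.KrizLiSchema
import HarnessLib

/-!
# Cell `bsd-print-cf2` (D-0131 (2) PRINT TIER, leaf CornerF @ `p = 2`), seat ty3 — display glue for the
# Kriz–Li twist-family certificate records at the PRINTED fibre `(243a1, ℚ(√−23))`: the minimal model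
# `y² + y = x³ + a₆` (`4a₆ + 1 = −3d³`) of `243a1^{(d)}` ON THE NOSE, and every CERTIFIED record a member BY NAME

HONEST FRAMING (cell `bsd-print-cf2`, run/shared/lean/pub/bsd-print-cf2/; verbatim): PARTITION currency
only — the leaf counts when its class theorem is in the kernel BY NAME; every imported theorem carries its
printed hypotheses verbatim. The leaf is OPEN AS A CLASS; nothing class-wide is closed here; theorems
only, no definition, no named fact. Companion of the Literature schema
`Rank1Residual/CornerFTwoCertificates/KrizLiSchema.lean` (ty3: the record FORMAT of the Kriz–Li
quadratic-twist families and its decidable recheck) and of p3's by-name slice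
`P2/KrizLiTwoFortyThree{Curve,Slices,Membership}.lean` (Kriz–Li 2019 Thm 1.12 = FMS Thm 5.1 (2) at
`E = 243a1`, `K = ℚ(√−23)`, the Table-1 row: `IsKrizLiTwoFortyThreeTwist`,
`isKrizLiTwoFortyThreeTwist_of_explicit`, `bsdp_two_of_isKrizLiTwoFortyThreeTwist`,
`analyticRank_of_twist_curve243a1`). This file says what a CERTIFIED Kriz–Li record with base data
`(d_K, c, badPrimes, N(E)) = (−23, 48, [2,3], 243)` gives for its curve, BY NAME:

* §1 a silent prime of the recheck IS a prime of `𝒮(243a1, ℚ(√−23))` (`IsKrizLiPrime243`, via p3's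
  decidable form `isKrizLiPrime243_iff`);
* §2 the MINIMAL MODEL ON THE NOSE: for `4a₆ + 1 = −3d³`, `(u,r,s,t) = (1,0,0,½)` carries
  `243a1^{(d)} : y² = x³ − (3/4)d³` to `W_d : y² + y = x³ + a₆`, which is a global minimal model when `d`
  is square-free and prime to `6` (`Δ(W_d) = −3⁵·d⁶`, `c₄ = 0`; Silverman VII.1 Rem 1.1), and is elliptic;
* §3 for every record `r` of a `KLCertified` list with that base data: `W_{r.d}` (= `r.ainvs`) has
  `ord_{s=1} L(W, s) = 1 ∧ BSD(W, 2)` BY NAME, granted exactly p3's binders `hKL h33 htab hS31 hBF hmod`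
  (Kriz–Li Thm 5.1 (2) / Thm 4.3, Table 1 row 243a1, Creutz–Miller, Burungale–Flach, modularity) — the
  recheck discharged `d > 0`, `d ≡ 1 (mod 12)`, `d` square-free, every prime of `d` silent; and every
  `ℚ`-model of `243a1^{(d)}` or of the partner `243a1^{(−23d)}` has `BSD(·, 2)`. Currency PRINT(TABLE)
  (the (★) input is Kriz–Li's printed Table 1 row); beyond-print theorem: NO (display glue).

References: [KrizLi2019] Thm 1.12 (FMS 5.1), Thm 4.3, Def 4.1, Lemma 5.1, §6 Ex 6.2, Table 1;
[Cremona1997] Table 1 (243A1); [SilvermanAEC2009] VII.1 Rem 1.1, X.5 Cor 5.4; [CreutzMiller2012] Thm 1.1;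
[BurungaleFlach2024] Cor 2; [Miller2011LMS] Def 1.1.
-/

noncomputable section

open scoped Classical

open WeierstrassCurve NumberField Literature.NumberTheory.EllipticCurves
  Literature.NumberTheory.EllipticCurves.Rank1Residual
  Literature.NumberTheory.EllipticCurves.ModularForms
  Literature.NumberTheory.EllipticCurves.Rank1Residual.X11RankOneCertificates
  Literature.NumberTheory.EllipticCurves.Rank1Residual.CornerFTwoCertificates
  Summit.BirchSwinnertonDyer.Rank1Residual

set_option autoImplicit false

namespace Summit.BirchSwinnertonDyer.Rank1Residual.P2

/-! ## §1 Silent primes of the recheck are primes of `𝒮(243a1, ℚ(√−23))` -/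

/-- A prime passing the recheck's `silentBit (−23) 48 [2,3]` is in `𝒮(243a1, ℚ(√−23))`
(`IsKrizLiPrime243`: prime, `∉ {2,3}`, `(−23/ℓ) = 1`, even number of cube roots of `48` in `𝔽_ℓ`).
[cite: KrizLi2019, Def. 4.1 (FMS) and §6 Ex. 6.2] -/
theorem isKrizLiPrime243_of_silentBit {ℓ : ℕ} (h : silentBit (-23) 48 [2, 3] ℓ = true) :
    IsKrizLiPrime243 ℓ := by
  obtain ⟨hp, hbad, -, hj, hev⟩ := silent_of_silentBit (by simp) h
  haveI : NeZero ℓ := ⟨hp.ne_zero⟩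
  refine isKrizLiPrime243_iff.2 ⟨hp, fun h2 => hbad (by simp [h2]), fun h3 => hbad (by simp [h3]), hj, ?_⟩
  simpa using hev

/-! ## §2 The minimal model `W_d : y² + y = x³ + a₆` (`4a₆ + 1 = −3d³`) of `243a1^{(d)}`, on the nose -/

/-- **The shift `y ↦ y + ½` carries `243a1^{(d)}` to `W_d : y² + y = x³ + a₆`** whenever `4a₆ + 1 = −3d³`
(`d ≡ 1 (mod 4)` makes `a₆` an integer). [cite: SilvermanAEC2009, III.1 (admissible change of variables) and X.5 Cor. 5.4] -/
theorem smul_quadraticTwist_curve243a1_eq_intModel {d a6 : ℤ} (ha : 4 * a6 + 1 = -(3 * d ^ 3)) :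
    (⟨1, 0, 0, 2⁻¹⟩ : VariableChange ℚ) • curve243a1.quadraticTwist (d : ℚ) =
      (⟨((0 : ℤ) : ℚ), ((0 : ℤ) : ℚ), ((1 : ℤ) : ℚ), ((0 : ℤ) : ℚ), (a6 : ℚ)⟩ : WeierstrassCurve ℚ) := by
  have ha' : (a6 : ℚ) = (-(3 * (d : ℚ) ^ 3) - 1) / 4 := by
    have : (4 : ℚ) * a6 + 1 = -(3 * (d : ℚ) ^ 3) := by exact_mod_cast ha
    linarith
  rw [quadraticTwist_curve243a1, ha']
  ext <;> norm_num [variableChange_a₁, variableChange_a₂, variableChange_a₃, variableChange_a₄,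
    variableChange_a₆]
  ring

/-- `Δ(W_d) = −27·(4a₆ + 1)²` in the tree's integer recheck `discOf`. [folklore] -/
theorem discOf_model243 (a6 : ℤ) : discOf [0, 0, 1, 0, a6] = -(27 * (4 * a6 + 1) ^ 2) := by
  simp only [discOf, invariants]
  ring

/-- **Silverman's criterion for `W_d`**: with `4a₆ + 1 = −3d³`, `d` square-free and prime to `6`, no prime
`q` has `q¹² ∣ Δ(W_d) = −3⁵·d⁶`. [cite: SilvermanAEC2009, VII.1 Remark 1.1] -/
theorem not_pow_twelve_dvd_disc_model243 {d : ℕ} {a6 : ℤ} (ha : 4 * a6 + 1 = -(3 * (d : ℤ) ^ 3))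
    (hsq : Squarefree d) (h3 : ¬ 3 ∣ d) {q : ℕ} (hq : q.Prime) : ¬ (q : ℤ) ^ 12 ∣ discOf [0, 0, 1, 0, a6] := by
  rw [discOf_model243, ha]
  intro h
  have h' : q ^ 12 ∣ 243 * d ^ 6 := by
    rw [← Int.natCast_dvd_natCast]; push_cast
    exact (dvd_neg.mpr h).trans (by ring_nf; exact dvd_rfl)
  by_cases hqd : q ∣ d
  · have hq3 : q ≠ 3 := by rintro rfl; exact h3 hqd
    have hcop : Nat.Coprime (q ^ 12) 243 := by
      have : Nat.Coprime q 3 := (Nat.coprime_primes hq Nat.prime_three).mpr hq3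
      simpa using this.pow 12 5
    have h6 : q ^ 12 ∣ d ^ 6 := hcop.dvd_of_dvd_mul_left h'
    have hsq' : q ^ 2 ∣ d := by
      rw [show q ^ 12 = (q ^ 2) ^ 6 by ring] at h6
      exact (Nat.pow_dvd_pow_iff (by norm_num)).mp h6
    have hu : IsUnit q := hsq q (by rw [← sq]; exact hsq')
    exact hq.one_lt.ne' (Nat.isUnit_iff.mp hu)
  · have hcop : Nat.Coprime (q ^ 12) (d ^ 6) := Nat.Coprime.pow 12 6 ((Nat.Prime.coprime_iff_not_dvd hq).mpr hqd)
    have h243 : q ^ 12 ∣ 243 := hcop.dvd_of_dvd_mul_right h'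
    have hle : q ^ 12 ≤ 243 := Nat.le_of_dvd (by norm_num) h243
    have hge : 2 ^ 12 ≤ q ^ 12 := Nat.pow_le_pow_left hq.two_le 12
    omega

/-- **`W_d : y² + y = x³ + a₆` is a globally minimal integer model** (`4a₆ + 1 = −3d³`, `d` square-free,
prime to `6`; `c₄ = 0`, so the criterion reduces to `q¹² ∤ Δ`). [cite: SilvermanAEC2009, VII.1 Remark 1.1 and VIII.8] -/
theorem isGloballyMinimal_model243 {d : ℕ} {a6 : ℤ} (ha : 4 * a6 + 1 = -(3 * (d : ℤ) ^ 3))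
    (hsq : Squarefree d) (h3 : ¬ 3 ∣ d) :
    (⟨((0 : ℤ) : ℚ), ((0 : ℤ) : ℚ), ((1 : ℤ) : ℚ), ((0 : ℤ) : ℚ), (a6 : ℚ)⟩ : WeierstrassCurve ℚ).IsGloballyMinimal :=
  isGloballyMinimal_of_int_criterion 0 0 1 0 a6 fun _ hq hand => not_pow_twelve_dvd_disc_model243 ha hsq h3 hq hand.1

/-- **`W_d` is an elliptic curve**: `Δ(W_d) = −27·(4a₆+1)² = −3⁵d⁶ ≠ 0` for `d ≠ 0`.
[cite: SilvermanAEC2009, III.1 Prop. 1.4] -/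
theorem isElliptic_model243 {d : ℕ} {a6 : ℤ} (ha : 4 * a6 + 1 = -(3 * (d : ℤ) ^ 3)) (hd : d ≠ 0) :
    (⟨((0 : ℤ) : ℚ), ((0 : ℤ) : ℚ), ((1 : ℤ) : ℚ), ((0 : ℤ) : ℚ), (a6 : ℚ)⟩ : WeierstrassCurve ℚ).IsElliptic := by
  rw [WeierstrassCurve.isElliptic_iff]
  have hΔ : (⟨((0 : ℤ) : ℚ), ((0 : ℤ) : ℚ), ((1 : ℤ) : ℚ), ((0 : ℤ) : ℚ), (a6 : ℚ)⟩ : WeierstrassCurve ℚ).Δ =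
      -(27 * (4 * (a6 : ℚ) + 1) ^ 2) := by
    simp [WeierstrassCurve.Δ, WeierstrassCurve.b₂, WeierstrassCurve.b₄, WeierstrassCurve.b₆,
      WeierstrassCurve.b₈]
    ring
  have h1 : (4 * (a6 : ℚ) + 1) = -(3 * (d : ℚ) ^ 3) := by exact_mod_cast ha
  rw [hΔ, h1, isUnit_iff_ne_zero, neg_ne_zero, mul_ne_zero_iff, neg_sq]
  have : (d : ℚ) ≠ 0 := Nat.cast_ne_zero.mpr hd
  exact ⟨by norm_num, by positivity⟩

/-! ## §3 Every CERTIFIED Kriz–Li record at the base `243a1` is a member by name -/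

/-- The primes of a certified `243a1` record's `d` are in `𝒮`, its `d` is an explicit member
(`0 < d`, `d ≡ 1 (mod 12)`, square-free): the hypotheses of `isKrizLiTwoFortyThreeTwist_of_explicit`, IN
THE KERNEL. [cite: KrizLi2019, Def. 4.1 and Thm. 5.1 (2)] -/
theorem explicit_of_check {r : KLRecord} (h : r.check = true) (hD : r.fieldDisc = -23) (hc : r.cubeConst = 48)
    (hb : r.badPrimes = [2, 3]) :
    (0 : ℤ) < (r.d : ℤ) ∧ (r.d : ℤ) % 12 = 1 ∧ Squarefree (r.d : ℤ).natAbs ∧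
      ∀ ℓ : ℕ, ℓ.Prime → ℓ ∣ (r.d : ℤ).natAbs → IsKrizLiPrime243 ℓ := by
  obtain ⟨hpos, h12, hsq, -, -, hsil⟩ := r.hyps_of_check h
  refine ⟨by exact_mod_cast hpos, by exact_mod_cast h12, by simpa using hsq, fun ℓ hℓ hℓd => ?_⟩
  have hℓd' : ℓ ∣ r.d := by simpa using hℓd
  have := (hsil ℓ hℓ hℓd').2
  rw [hD, hc, hb] at this
  exact isKrizLiPrime243_of_silentBit this

/-- **`BSD(W, 2)` for every `ℚ`-model `W` of `243a1^{(d)}` or of its partner `243a1^{(−23d)}`, for every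
record of a certified list at the base `243a1`, BY NAME** (binders `hKL h33 htab hS31 hBF hmod` =
Kriz–Li Thm 5.1 (2), Thm 4.3, Table 1 row 243a1, Creutz–Miller `N < 5000`, Burungale–Flach, modularity).
[cite: KrizLi2019, Thm. 5.1 (2), Thm. 4.3, Def. 4.1 and Table 1 (row 243a1)] [cite: CreutzMiller2012, Thm. 1.1]
[cite: BurungaleFlach2024, Thm. 1.1 and Cor. 2] [cite: Miller2011LMS, Def. 1.1] -/
theorem bsdp_two_of_klCertified_243 (hKL : KrizLi2019.thm112_bsdTwo_twist) (h33 : KrizLi2019.thm33_rank_twist)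
    (htab : KrizLi2019.table1_row243a1) (hS31 : bsdTriple_of_analyticRank_le_one_of_conductor_lt)
    (hBF : bsdTriple_of_hasCM_of_L_one_ne_zero) (hmod : hasEntireLFunction_rat)
    {rs : List KLRecord} (h : KLCertified rs) :
    ∀ r ∈ rs, r.fieldDisc = -23 → r.cubeConst = 48 → r.badPrimes = [2, 3] →
      ∀ (W : WeierstrassCurve ℚ) [W.IsElliptic] [W.IsGloballyMinimal] (C : VariableChange ℚ),
        (C • curve243a1.quadraticTwist ((r.d : ℤ) : ℚ) = W ∨
          C • curve243a1.quadraticTwist ((-23 * (r.d : ℤ) : ℤ) : ℚ) = W) → BSDp W 2 := by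
  intro r hr hD hc hb W _ _ C hC
  obtain ⟨hd0, hd12, hsq, hprimes⟩ := explicit_of_check (h.check_of_mem hr) hD hc hb
  exact bsdp_two_of_isKrizLiTwoFortyThreeTwist hKL h33 htab hS31 hBF hmod W
    (isKrizLiTwoFortyThreeTwist_of_explicit hd0 hd12 hsq hprimes hC)

/-- **THE MINIMAL MODEL OF THE RECORD, ON THE NOSE**: for every record `r` of a certified list at the base
`243a1`, the curve `W = ⟨0, 0, 1, 0, a₆⟩` with `r.ainvs = [0,0,1,0,a₆]` (the recheck verified
`4a₆ + 1 = −3d³`) is a globally minimal elliptic curve with `ord_{s=1} L(W, s) = 1` and `BSD(W, 2)` — the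
rank-one member `243a1^{(d)}` of the leaf `CornerF @ 2`, BY NAME (binders as above).
[cite: KrizLi2019, Thm. 5.1 (2), Thm. 4.3 and Table 1 (row 243a1)] [cite: CreutzMiller2012, Thm. 1.1]
[cite: BurungaleFlach2024, Cor. 2] [cite: SilvermanAEC2009, VII.1 Remark 1.1] [cite: Miller2011LMS, Def. 1.1] -/
theorem analyticRank_eq_one_and_bsdp_two_of_klCertified_243 (hKL : KrizLi2019.thm112_bsdTwo_twist)
    (h33 : KrizLi2019.thm33_rank_twist) (htab : KrizLi2019.table1_row243a1)
    (hS31 : bsdTriple_of_analyticRank_le_one_of_conductor_lt) (hBF : bsdTriple_of_hasCM_of_L_one_ne_zero)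
    (hmod : hasEntireLFunction_rat) {rs : List KLRecord} (h : KLCertified rs) :
    ∀ r ∈ rs, r.fieldDisc = -23 → r.cubeConst = 48 → r.badPrimes = [2, 3] → r.baseConductor = 243 →
      ∃ a6 : ℤ, r.ainvs = [0, 0, 1, 0, a6] ∧
        ∃ (_ : (⟨((0 : ℤ) : ℚ), ((0 : ℤ) : ℚ), ((1 : ℤ) : ℚ), ((0 : ℤ) : ℚ), (a6 : ℚ)⟩ : WeierstrassCurve ℚ).IsElliptic)
          (_ : (⟨((0 : ℤ) : ℚ), ((0 : ℤ) : ℚ), ((1 : ℤ) : ℚ), ((0 : ℤ) : ℚ), (a6 : ℚ)⟩ : WeierstrassCurve ℚ).IsGloballyMinimal),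
          (⟨((0 : ℤ) : ℚ), ((0 : ℤ) : ℚ), ((1 : ℤ) : ℚ), ((0 : ℤ) : ℚ), (a6 : ℚ)⟩ : WeierstrassCurve ℚ).analyticRank = 1 ∧
            BSDp (⟨((0 : ℤ) : ℚ), ((0 : ℤ) : ℚ), ((1 : ℤ) : ℚ), ((0 : ℤ) : ℚ), (a6 : ℚ)⟩ : WeierstrassCurve ℚ) 2 := by
  intro r hr hD hc hb hN
  have hchk := h.check_of_mem hr
  obtain ⟨a6, hA, ha, -⟩ := r.model243_of_check hchk hN
  obtain ⟨hd0, hd12, hsq, hprimes⟩ := explicit_of_check hchk hD hc hb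
  obtain ⟨hpos, -, hsqN, -, -, hsil⟩ := r.hyps_of_check hchk
  have h3 : ¬ 3 ∣ r.d := fun h3 => by
    have := (silent_of_silentBit (bad := r.badPrimes) (by rw [hb]; simp) (hsil 3 Nat.prime_three h3).2).2.1
    rw [hb] at this
    simp at this
  haveI hE := isElliptic_model243 ha (Nat.pos_iff_ne_zero.mp hpos)
  haveI hM := isGloballyMinimal_model243 ha hsqN h3
  refine ⟨a6, hA, hE, hM, ?_, ?_⟩
  · -- analytic rank one: Kriz–Li Thm 4.3 on the pair (W_d, a minimal model of the partner)
    have hIn := inN_curve243a1 (sqrtField.finrank_eq_two _) isImaginaryQuadratic_and_discr_sqrtField_neg_twentyThree.2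
      (by omega) hsq hprimes
    have hsign := sign_mul_jacobiSym_conductorNorm_curve243a1 hd0 hd12
    have hd' : ((-23 * (r.d : ℤ) : ℤ) : ℚ) ≠ 0 := by
      have : (r.d : ℚ) ≠ 0 := Nat.cast_ne_zero.mpr (Nat.pos_iff_ne_zero.mp hpos)
      push_cast
      exact mul_ne_zero (by norm_num) this
    obtain ⟨W₂, _, _, hW₂⟩ := P2.exists_globallyMinimal_twist curve243a1 hd'
    exact (analyticRank_of_twist_curve243a1 h33 htab hBF hmod hIn hsign _ W₂
      ⟨⟨1, 0, 0, 2⁻¹⟩, smul_quadraticTwist_curve243a1_eq_intModel ha⟩ hW₂).1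
  · exact bsdp_two_of_isKrizLiTwoFortyThreeTwist hKL h33 htab hS31 hBF hmod _
      (isKrizLiTwoFortyThreeTwist_of_explicit hd0 hd12 hsq hprimes
        (C := ⟨1, 0, 0, 2⁻¹⟩) (Or.inl (smul_quadraticTwist_curve243a1_eq_intModel ha)))

end Summit.BirchSwinnertonDyer.Rank1Residual.P2

end
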